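import Summits.Ventures.AbcSig.Rows.XTemplateB
import Summits.Ventures.AbcSig.Rows.TemplateBC
import Summits.Ventures.AbcSig.Rows.TemplateC2a

/-!
# Venture AbcSig — EXTENDED ROW TEMPLATE for `xⁿ + 64 yⁿ = C z²`, `y` odd (FAMILY C1b, `α = 6`): case (v₆), level `C²`

HONEST FRAMING. Fully PROVED template theorem of a COMPUTATION cell (`pub-abcsig`); CONDITIONAL on named hypotheses,
no claim on ABC or any summit. Companion of `Rows/TemplateBC.lean` / `Rows/XTemplateBC.lean` for the `α = 6` cells of
FAMILY C1b (`census/rows/C1b/C1b-C<C>-a6.md`, p1's conjuncts `Rows.C1bCell C (fun _ α => α = 6) n₀ R`): a primitive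
solution of `xⁿ + 2⁶ yⁿ = C z²` with `y` ODD has `ord₂(2⁶ yⁿ) = 6` exactly, i.e. case (v₆) of [BS04, Lemma 2.1/3.2]
(after the sign change `c ≡ C (mod 4)`), Serre level `2⁰ · C² = C²`; with `y` EVEN it is case (v₇) at level `2C²`
(`xbranchBC_v7` of `Rows/XTemplateBC.lean`, any `α < n`). Per-orbit alternative
`o.Eliminated bs04Allowed n ∨ (M.Excludes (C²) o (famBC 6 C n (y odd)) ∨ M.ExcludesStd (C²) o n)`, final step
`xno_solution_in_case` (`Rows/XTemplateB.lean`); `ordTwoEq_twoPow_mul_odd` is from `Rows/TemplateC2a.lean`.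

* `bs04Level_one_twoPow_v6` — the (v₆) level for `(1, 2^α, C)` is `C²`;
* `xbranchBC_v6` — the template theorem (`y` odd, `α = 6`, level `C²`).

Reference: [BS04] M. A. Bennett, C. M. Skinner, Canad. J. Math. 56 (2004) 23–54, §§2–4 and Thm. 1.2.
-/

namespace Summit.Ventures.AbcSig

/-- For odd squarefree `C`, `n ∤ C` and any `α`: the case-(v₆) Serre level for `(A, B, C) = (1, 2^α, C)` is `C²`. -/
theorem bs04Level_one_twoPow_v6 (α C n : ℕ) (hsq : Squarefree C) (hodd : Odd C) (hnC : ¬ n ∣ C) :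
    bs04Level .v₆ 1 (2 ^ α) C n = C ^ 2 := by
  simp only [bs04Level, FreyCase.twoExp, bs04OddLevel_one_twoPow α C n hsq hodd hnC]
  norm_num

/-- EXTENDED **Branch (v₆), `y` odd, `α = 6`**: level `C²`. For odd squarefree `C`, a prime `n ≥ 7` with `n ∤ C`, and
the cell's hypotheses at level `C²` for the family "`(1, 64, C)`, exponent `n`, `y` odd" (kernel sieve certificate, or
a cited exclusion, or a standing-datum exclusion `ExcludesStd` from a kernel module certificate), there is no primitive
solution of `xⁿ + 64 yⁿ = C z²` with `y` odd and `xy ≠ ±1`. -/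
theorem xbranchBC_v6 (C : ℕ) (hsq : Squarefree C) (hCodd : Odd C) (M : NewformModel)
    (hP : M.BS04Package) {orbs : List OrbitData} (hD : M.DataComplete (C ^ 2) orbs)
    (n : ℕ) (hn : n.Prime) (h7 : 7 ≤ n) (hnC : ¬ n ∣ C)
    (hS : ∀ o ∈ orbs, (∀ e ∈ o.coeffs, e.ell.Prime ∧ e.ell ≠ 2 ∧ ¬ e.ell ∣ C ^ 2) ∧
      (o.Eliminated bs04Allowed n ∨ (M.Excludes (C ^ 2) o (famBC 6 C n (fun _ b => ¬ 2 ∣ b)) ∨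
        M.ExcludesStd (C ^ 2) o n)))
    (x y z : ℤ) (hy : ¬ 2 ∣ y) (h1 : x * y ≠ 1) (h2 : x * y ≠ -1) :
    ¬ IsPrimitiveSolution 1 (2 ^ 6) C n x y z := by
  intro hsol
  have hCpos : 0 < C := hCodd.pos
  have hCoddZ : ¬ 2 ∣ (C : ℤ) := by
    intro h
    have h' : (2 : ℕ) ∣ C := by exact_mod_cast h
    exact (Nat.not_even_iff_odd.mpr hCodd) (even_iff_two_dvd.mpr h')
  have hBb : 2 ∣ ((2 ^ 6 : ℕ) : ℤ) * y := Dvd.dvd.mul_right (by norm_num) _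
  have hCz := odd_Cc_of_two_dvd_Bb hsol hBb
  have hz : ¬ 2 ∣ z := fun h => hCz (Dvd.dvd.mul_left h _)
  obtain ⟨z', hz'sgn, hz'⟩ := exists_sign_sub_four_dvd z C hz hCoddZ
  have hsol' : IsPrimitiveSolution 1 (2 ^ 6) C n x y z' := hsol.of_sign hz'sgn
  have hyn : ¬ 2 ∣ y ^ n := fun h => hy (Int.prime_two.dvd_of_dvd_pow h)
  have hv : OrdTwoEq (((2 ^ 6 : ℕ) : ℤ) * y ^ n) 6 := by
    have := ordTwoEq_twoPow_mul_odd 6 (y ^ n) hyn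
    simpa using this
  have hcase : FreyCase.Holds .v₆ 1 (2 ^ 6) C n x y z' := ⟨hv, hz'⟩
  have hndvd : ¬ n ∣ 1 * 2 ^ 6 * C := by
    intro h
    rw [one_mul] at h
    rcases (Nat.Prime.dvd_mul hn).mp h with h2 | hC
    · have := (Nat.prime_dvd_prime_iff_eq hn Nat.prime_two).mp (hn.dvd_of_dvd_pow h2)
      omega
    · exact hnC hC
  exact xno_solution_in_case M hP ⟨1, 2 ^ 6, C, n, x, y, z'⟩ .v₆ (C ^ 2) one_pos (by positivity) hCpos hsq hn h7
    hndvd (nthPowerFree_one_twoPow 6 n (by omega) (by omega)) hsol' h1 h2 hcase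
    (bs04Level_one_twoPow_v6 6 C n hsq hCodd hnC) hD (famBC 6 C n (fun _ b => ¬ 2 ∣ b)) ⟨rfl, rfl, rfl, rfl, hy⟩ hS

end Summit.Ventures.AbcSig
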